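import Summits.CriticalPhenomena.PercolationContinuityZ3.Theorems.PercNearOneGluingNoHeavyLowerTailSunflowerRainbowLinearDichotomy
import HarnessLib
import HarnessLib.Audit

/-!
# `NoHeavyLowerTail` (crux stmt-CriticalPhenomena-4575), abstract sunflower cubic: BILINEAR CERTIFICATES for the rainbow matroid partition —
# the linear-extension dichotomy (ZZ_L) is EQUIVALENT to a unitriangular "mixed Gram matrix", and one product-order certificate gives (ZZ_L)
# for every linear extension at once

Support file (seat `prim-l12-p2` gen 23; `--supports stmt-CriticalPhenomena-4575`).  No `sorry`.  One new definition, the `@[conjecture]`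
`RainbowCertificate` (an obligation of this programme — census-true, unproved —, never a fact).
Memo: run/shared/lean/prim/prim-l12/prim-l12-p2/FINDING-g23-BILINEAR-CERTIFICATE.md.

SETTING (gens 18–22).  Rainbows `ρ = (Q1,Q2,Q3)`; `TS-B_ρ = F.tsB ρ` (two-stage vector on the bottom-spectator supplies), `TS-A_ρ = F.tsA ρ`
(kernel-spectator supplies); `RainbowMatroidPartition` (MP): the rainbows split as `R_B ⊔ R_A` with `{TS-B}_{R_B}`, `{TS-A}_{R_A}` linearly
independent over `GF(2)`; MP ⟹ ★ (`PartitionLemmaH`).  `RainbowLinearDichotomy` (ZZ_L, gen 22, census-clean): along every injective rank `r`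
monotone w.r.t. `RbBelow`, no rainbow is both B-dependent on the `r`-earlier and A-dependent on the `r`-later rainbows; (ZZ_L) ⟹ MP.

THE CERTIFICATE (this file).  A family of functionals `λ_a` on the bottom-spectator supplies and `κ_c` on the kernel-spectator supplies, one per
rainbow, defines the MIXED GRAM MATRIX  `G(a,c) := ⟨λ_a, TS-B_c⟩ + ⟨κ_c, TS-A_a⟩`  (`Sunflower.certPair`; NOTE the transposition on the A-part —
the reader of the COLUMN `c` listens to the A-vector of the ROW `a`; the cube-dual certificate of gen 19 pairs both parts with the row and is a
certificate for `RainbowKernelIndependence` instead).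
* `certPair_diag_eq_zero` (abstract linear algebra, any commutative ring): if `v_B = Σ f_i w_i`, `v_A = Σ f'_j w'_j` and the mixed pairings
  vanish on the pairs (ρ, c_i), (a_j, ρ), (a_j, c_i), then `⟨λ_ρ,v_B⟩ + ⟨κ_ρ,v_A⟩ = 0` — four exchanges of summation.
* `Sunflower.rank_dichotomy_of_certificate` — ONE sunflower, ANY rank `r`: if `G(a,a) = 1` and `G(a,c) = 0` whenever `a ≠ c` and `¬ r a < r c`
  (`G` is upper-unitriangular along `r`), then the dichotomy along `r` holds (no rainbow is B-dependent on the `r`-earlier AND A-dependent on the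
  `r`-later ones); with `exists_matroidPartition_of_rank` (gen 22) this gives MP for that sunflower (`exists_matroidPartition_of_certificate`).
  [Conversely — not formalised, elementary — a matroid partition `R_B ⊔ R_A` yields such a certificate for the order "`R_B` first": dual-basis
  functionals on each side, zero on the other; and (ZZ_L) for `r` yields an `r`-unitriangular certificate by separating hyperplanes.  So
  "unitriangular mixed Gram matrix along SOME linear order" ⟺ MP, and "along `r`" ⟺ the dichotomy along `r`.]
* `RainbowCertificate` (typed conjecture, this work): every sunflower admits a certificate that is unitriangular w.r.t. the PRODUCT ORDER itself:
  `G(a,a) = 1` and `G(a,c) = 0` unless `a = c` or `RbBelow a c` (`a` strictly below `c`).  It implies (ZZ_L) for EVERY monotone injective rank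
  simultaneously (`rainbowLinearDichotomy_of_rainbowCertificate`), hence MP and ★ (`partitionLemmaH_of_rainbowCertificate`).
  DUAL FORM (linear algebra, memo §2): such a certificate exists iff every matrix `H` in `K_A ⊗ K_B` (columns A-cycles, rows B-cycles of the
  rainbows) that vanishes on the strict up-cone `{(a,c) : RbBelow a c}` has even trace.  The naive candidate `G = ζ_{⊴}` (the zeta matrix of the
  product order) is NOT a certificate (fails on the 6-point twin instance of gen 22), and the split form "λ-part and κ-part separately triangular"
  is exactly the refuted partial-order dichotomy `RainbowDichotomy`: cancellation between the two parts at incomparable pairs (twins) is essential.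
  CENSUS (gen 23, `code/tri.c`, exact GF(2) linear algebra per instance): a product-order certificate exists in every instance tested —
  all-petals-non-intersecting sunflowers on 7 points (20 000; 871 with both cycle spaces non-zero) and 8 points (100 000; 6 695), random 7-point
  sunflowers (20 000), the composition family `θ(4 points)∘gadgets` on ≤ 7 points (655 077 instances with rainbows; 2 506 with both cycle spaces
  non-zero — the family containing the twin counterexamples to `RainbowDichotomy`), the cyclic star `CS(3,3,3)` on 9 points with 39 relabelled
  neighbours; the controls "diagonal certificate" and "reversed product order" are infeasible in about half of these.
-/

namespace Summit.CriticalPhenomena.PercolationContinuityZ3.Theorems.SunflowerPartition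

open Finset

/-! ## Abstract linear algebra: the mixed pairing of a doubly dependent element vanishes -/

/-- **Four exchanges of summation** (this work).  Over a commutative ring: let `vB = Σ_i f i • wB i` and `vA = Σ_j f' j • wA j`.  If the mixed
pairings `⟨lam, wB i⟩ + ⟨kB i, vA⟩`, `⟨lA j, vB⟩ + ⟨kap, wA j⟩` and `⟨lA j, wB i⟩ + ⟨kB i, wA j⟩` all vanish, then `⟨lam, vB⟩ + ⟨kap, vA⟩ = 0`.
(`lam, kap` are the two functionals of the element itself, `kB i` the A-functional of the `i`-th B-generator, `lA j` the B-functional of the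
`j`-th A-generator.) [this work] -/
theorem certPair_diag_eq_zero {K : Type*} [CommRing K] {m m' : Type*} [Fintype m] [Fintype m'] {nB nA : ℕ}
    (vB lam : m → K) (vA kap : m' → K) (wB : Fin nB → m → K) (kB : Fin nB → m' → K) (wA : Fin nA → m' → K) (lA : Fin nA → m → K)
    (f : Fin nB → K) (f' : Fin nA → K)
    (hB : ∑ i, f i • wB i = vB) (hA : ∑ j, f' j • wA j = vA)
    (h1 : ∀ i, lam ⬝ᵥ wB i + kB i ⬝ᵥ vA = 0) (h2 : ∀ j, lA j ⬝ᵥ vB + kap ⬝ᵥ wA j = 0)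
    (h3 : ∀ i j, lA j ⬝ᵥ wB i + kB i ⬝ᵥ wA j = 0) :
    lam ⬝ᵥ vB + kap ⬝ᵥ vA = 0 := by
  have e1 : lam ⬝ᵥ vB = -∑ i, f i * (kB i ⬝ᵥ vA) := by
    rw [← hB, dotProduct_sum, ← Finset.sum_neg_distrib]
    refine Finset.sum_congr rfl fun i _ => ?_
    rw [dotProduct_smul, smul_eq_mul, eq_neg_of_add_eq_zero_left (h1 i), mul_neg]
  have e2 : ∀ i, kB i ⬝ᵥ vA = -∑ j, f' j * (lA j ⬝ᵥ wB i) := by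
    intro i
    rw [← hA, dotProduct_sum, ← Finset.sum_neg_distrib]
    refine Finset.sum_congr rfl fun j _ => ?_
    rw [dotProduct_smul, smul_eq_mul, eq_neg_of_add_eq_zero_right (h3 i j), mul_neg]
  have e3 : ∀ j, lA j ⬝ᵥ vB = ∑ i, f i * (lA j ⬝ᵥ wB i) := by
    intro j
    rw [← hB, dotProduct_sum]
    exact Finset.sum_congr rfl fun i _ => by rw [dotProduct_smul, smul_eq_mul]
  have e4 : kap ⬝ᵥ vA = -∑ j, f' j * (lA j ⬝ᵥ vB) := by
    rw [← hA, dotProduct_sum, ← Finset.sum_neg_distrib]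
    refine Finset.sum_congr rfl fun j _ => ?_
    rw [dotProduct_smul, smul_eq_mul, eq_neg_of_add_eq_zero_right (h2 j), mul_neg]
  -- both sides are the same double sum
  have eL : lam ⬝ᵥ vB = ∑ i, ∑ j, f i * (f' j * (lA j ⬝ᵥ wB i)) := by
    rw [e1, ← Finset.sum_neg_distrib]
    refine Finset.sum_congr rfl fun i _ => ?_
    rw [e2 i, mul_neg, neg_neg, Finset.mul_sum]
  have eR : kap ⬝ᵥ vA = -∑ i, ∑ j, f i * (f' j * (lA j ⬝ᵥ wB i)) := by
    rw [e4, Finset.sum_comm]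
    congr 1
    refine Finset.sum_congr rfl fun j _ => ?_
    rw [e3 j, Finset.mul_sum]
    exact Finset.sum_congr rfl fun i _ => by ring
  rw [eL, eR, add_neg_cancel]

variable {α : Type*} [Fintype α] [DecidableEq α]

namespace Sunflower

variable (F : Sunflower α)

/-- The index type of the BOTTOM-spectator supplies (domain of `TS-B`); an abbreviation, so that certificate binders unify by name. [this work] -/
abbrev SupB : Type _ := ↥(F.sup.filter (fun σ => F.lab σ.2 = 0))

/-- The index type of the KERNEL-spectator supplies (domain of `TS-A`). [this work] -/
abbrev SupA : Type _ := ↥(F.sup.filter (fun σ => F.lab σ.2 = 4))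

/-- The MIXED GRAM MATRIX of a certificate `(lam, kap)`: `G(a,c) = ⟨lam a, TS-B c⟩ + ⟨kap c, TS-A a⟩` (the A-part is read by the COLUMN). [this work] -/
def certPair (lam : Finset α × Finset α → F.SupB → ZMod 2) (kap : Finset α × Finset α → F.SupA → ZMod 2)
    (a c : Finset α × Finset α) : ZMod 2 :=
  lam a ⬝ᵥ F.tsB c + kap c ⬝ᵥ F.tsA a

/-- **Rank dichotomy from a unitriangular certificate** (this work).  For ONE sunflower and ANY rank `r`: if `G(a,a) = 1` on the rainbows and
`G(a,c) = 0` for rainbows `a ≠ c` with `¬ r a < r c`, then no rainbow `ρ` has both `TS-B ρ ∈ span{TS-B ρ' : r ρ' < r ρ}` and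
`TS-A ρ ∈ span{TS-A ρ' : r ρ < r ρ'}`.  (Writing the two memberships as finite combinations, `certPair_diag_eq_zero` gives `G(ρ,ρ) = 0`.) [this work] -/
theorem rank_dichotomy_of_certificate (r : Finset α × Finset α → ℕ)
    (lam : Finset α × Finset α → F.SupB → ZMod 2) (kap : Finset α × Finset α → F.SupA → ZMod 2)
    (hdiag : ∀ a ∈ F.rainbows, F.certPair lam kap a a = 1)
    (hoff : ∀ a ∈ F.rainbows, ∀ c ∈ F.rainbows, a ≠ c → ¬ r a < r c → F.certPair lam kap a c = 0) :
    ∀ ρ ∈ F.rainbows, ¬ (F.tsB ρ ∈ Submodule.span (ZMod 2) (F.tsB '' {ρ' | ρ' ∈ F.rainbows ∧ r ρ' < r ρ}) ∧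
                       F.tsA ρ ∈ Submodule.span (ZMod 2) (F.tsA '' {ρ' | ρ' ∈ F.rainbows ∧ r ρ < r ρ'})) := by
  classical
  intro ρ hρ h
  obtain ⟨hmemB, hmemA⟩ := h
  obtain ⟨nB, f, g, hg⟩ := Submodule.mem_span_set'.1 hmemB
  obtain ⟨nA, f', g', hg'⟩ := Submodule.mem_span_set'.1 hmemA
  -- choose the generating rainbows
  have hcB : ∀ i, ∃ c, (c ∈ F.rainbows ∧ r c < r ρ) ∧ F.tsB c = (g i : _) := fun i => (g i).2
  have hcA : ∀ j, ∃ a, (a ∈ F.rainbows ∧ r ρ < r a) ∧ F.tsA a = (g' j : _) := fun j => (g' j).2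
  choose cB hcB1 hcB2 using hcB
  choose cA hcA1 hcA2 using hcA
  have key := certPair_diag_eq_zero (K := ZMod 2) (F.tsB ρ) (lam ρ) (F.tsA ρ) (kap ρ)
    (fun i => F.tsB (cB i)) (fun i => kap (cB i)) (fun j => F.tsA (cA j)) (fun j => lam (cA j)) f f'
    (by rw [← hg]; exact Finset.sum_congr rfl fun i _ => by rw [hcB2 i])
    (by rw [← hg']; exact Finset.sum_congr rfl fun j _ => by rw [hcA2 j])
    (fun i => by
      have hne : ρ ≠ cB i := fun heq => by have := (hcB1 i).2; rw [← heq] at this; exact lt_irrefl _ this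
      have hnlt : ¬ r ρ < r (cB i) := fun hlt => lt_asymm hlt (hcB1 i).2
      exact hoff ρ hρ (cB i) (hcB1 i).1 hne hnlt)
    (fun j => by
      have hne : cA j ≠ ρ := fun heq => by have := (hcA1 j).2; rw [heq] at this; exact lt_irrefl _ this
      have hnlt : ¬ r (cA j) < r ρ := fun hlt => lt_asymm hlt (hcA1 j).2
      exact hoff (cA j) (hcA1 j).1 ρ hρ hne hnlt)
    (fun i j => by
      have hlt : r (cB i) < r (cA j) := lt_trans (hcB1 i).2 (hcA1 j).2
      have hne : cA j ≠ cB i := fun heq => by rw [heq] at hlt; exact lt_irrefl _ hlt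
      have hnlt : ¬ r (cA j) < r (cB i) := fun h => lt_asymm h hlt
      exact hoff (cA j) (hcA1 j).1 (cB i) (hcB1 i).1 hne hnlt)
  have h1 := hdiag ρ hρ
  unfold certPair at h1
  rw [key] at h1
  exact zero_ne_one h1

/-- **Matroid partition from a unitriangular certificate, one sunflower** (this work): an injective rank `r` and a certificate unitriangular
along `r` give a rainbow matroid partition. [this work] -/
theorem exists_matroidPartition_of_certificate (r : Finset α × Finset α → ℕ) (hinj : Set.InjOn r ↑F.rainbows)
    (lam : Finset α × Finset α → F.SupB → ZMod 2) (kap : Finset α × Finset α → F.SupA → ZMod 2)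
    (hdiag : ∀ a ∈ F.rainbows, F.certPair lam kap a a = 1)
    (hoff : ∀ a ∈ F.rainbows, ∀ c ∈ F.rainbows, a ≠ c → ¬ r a < r c → F.certPair lam kap a c = 0) :
    ∃ RB RA : Finset (Finset α × Finset α),
      RB ⊆ F.dem.filter (fun d => F.IsRainbow d) ∧ RA ⊆ F.dem.filter (fun d => F.IsRainbow d) ∧ Disjoint RB RA ∧
      RB ∪ RA = F.dem.filter (fun d => F.IsRainbow d) ∧
      LinearIndependent (ZMod 2)
        (fun ρ : ↥RB => fun σ : ↥(F.sup.filter (fun σ => F.lab σ.2 = 0)) => F.rbVec ρ.1 σ.1) ∧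
      LinearIndependent (ZMod 2)
        (fun ρ : ↥RA => fun σ : ↥(F.sup.filter (fun σ => F.lab σ.2 = 4)) => F.rbVec ρ.1 σ.1) :=
  F.exists_matroidPartition_of_rank r hinj (F.rank_dichotomy_of_certificate r lam kap hdiag hoff)

end Sunflower

/-! ## The typed conjecture: a certificate unitriangular w.r.t. the product order -/

/-- **RAINBOW CERTIFICATE** (this work; OPEN, census-clean — file header): every sunflower admits functionals `λ_a` (on the bottom-spectator
supplies) and `κ_c` (on the kernel-spectator supplies), one per rainbow, whose mixed Gram matrix `G(a,c) = ⟨λ_a, TS-B_c⟩ + ⟨κ_c, TS-A_a⟩`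
is UNITRIANGULAR FOR THE PRODUCT ORDER: `G(a,a) = 1`, and `G(a,c) = 0` unless `a = c` or `a` lies strictly below `c` (`RbBelow a c`).
Equivalently: every matrix in `K_A ⊗ K_B` vanishing on the strict up-cone has even trace.  Implies `RainbowLinearDichotomy` for all linear
extensions at once, hence MP and ★.  An obligation, never a fact: use as `(h : RainbowCertificate)`. [status: open] -/
@[conjecture] def RainbowCertificate : Prop :=
  ∀ (α : Type) [Fintype α] [DecidableEq α] (F : Sunflower α),
    ∃ (lam : Finset α × Finset α → F.SupB → ZMod 2) (kap : Finset α × Finset α → F.SupA → ZMod 2),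
      (∀ a ∈ F.rainbows, F.certPair lam kap a a = 1) ∧
      (∀ a ∈ F.rainbows, ∀ c ∈ F.rainbows, a ≠ c → ¬ RbBelow a c → F.certPair lam kap a c = 0)

/-- **`RainbowCertificate → RainbowLinearDichotomy`** (this work): a product-order certificate is unitriangular along every injective rank
that is monotone w.r.t. `RbBelow`. [this work] -/
theorem rainbowLinearDichotomy_of_rainbowCertificate (h : RainbowCertificate) : RainbowLinearDichotomy := by
  intro α _ _ F r _ hmono
  obtain ⟨lam, kap, hdiag, hoff⟩ := h α F
  refine F.rank_dichotomy_of_certificate r lam kap hdiag fun a ha c hc hne hnlt => hoff a ha c hc hne ?_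
  exact fun hb => hnlt (hmono a c ha hc hb)

/-- **`RainbowCertificate → RainbowMatroidPartition`** (this work). [this work] -/
theorem rainbowMatroidPartition_of_rainbowCertificate (h : RainbowCertificate) : RainbowMatroidPartition :=
  rainbowMatroidPartition_of_rainbowLinearDichotomy (rainbowLinearDichotomy_of_rainbowCertificate h)

/-- **`RainbowCertificate → PartitionLemmaH`** (★). [this work] -/
theorem partitionLemmaH_of_rainbowCertificate (h : RainbowCertificate) : PartitionLemmaH :=
  partitionLemmaH_of_rainbowLinearDichotomy (rainbowLinearDichotomy_of_rainbowCertificate h)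

end Summit.CriticalPhenomena.PercolationContinuityZ3.Theorems.SunflowerPartition
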